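/-
Copyright (c) 2026 the pub-hodgecm-mathlib formalisation cell (harness21).  Prover seat hodgecm-mathlib-A-p19 (g26): T3′ P-2 row (R2²) organ [T2-c], layer 3
«THE UNIT INDEX `[C : R^×] = (q+1) q^{N+n−1}` OF THE TYPE-(2) ORDER» (road «S3-tree», crux H413).
-/
import Literature.NumberTheory.Automorphic.QuadraticRamifiedOrderMonogenic      -- ★ p846557 (this seat): the order `R = 𝒪[(u,λ)] ≤ 𝒪 × O₁`: index, locality, conductor, `[Λ^× : R^×]`
import Literature.RingTheory.GaloisAlgebras.InvolutionDescentUnitIndex         -- ★ p846524 (this seat): `index_eq_relIndex_eqLocus_sq`, `range_norm_eq_units_eqLocus`, `relIndex_comap_norm_mul_relIndex_eq_index`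
import Literature.NumberTheory.Automorphic.SplitTorusOrderUnitIndex            -- ★ p845818 O8a-5E (F0P3-p02): `mem_range_units_map_subtype_iff`
import HarnessLib

/-!
# The type-(2) unit index: `[C : R^×] = (q + 1) · q^{N+n−1}` for `R = 𝒪_E[(u, λ)] ≤ 𝒪_E × 𝒪[K₁]`, `C = {c : c·c⋆ ∈ R^×}`

Topic `NumberTheory/Automorphic`; namespace `Literature.NumberTheory.Automorphic`.  THEOREMS ONLY (no definition, no instance, no notation, no named fact, no `sorry`); (D0) currency with
TWO valued fields `F → E` (the inert dictionary of ★ Σ2-F∕Σ2-CM: `ιO : 𝒪[F] →+* 𝒪[E]`, involution `σO` of `𝒪[E]` with fixed ring `ιO 𝒪[F]`, `q_E = q_F²`, unit norms onto) and the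
ABSTRACT ramified quadratic ring `O₁ = j𝒪_E ⊕ j𝒪_E θ` of ★ `QuadraticRamifiedOrderUnitIndex` with an involution `σ₁` over `σO` fixing `θ` (unit norms onto: `K₁ ∕ K` unramified).
Cell `pub/hodgecm-mathlib`, crux H413 = `stmt-HodgeConjecture-24833`; road «S3-tree», T3′ P-2 row (R2²) «THE FREE ROW, TYPE (2)» (architect A-p16 (g30) A-106∕A-110), organ [T2-c]
layer 3 = the type-(2) twin of ★ Σ2-F (d) + ★ O8a-5Σ `relIndex_units_adjoin_comap_norm_eq`.
HONEST LABEL: HC_CM is proved only modulo the 2 remaining named inputs (hLiu418 24832, h413 24833) until rung 0 closes; commutative algebra, asserts nothing printed.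

THE MATHEMATICS.  `Λ = 𝒪_E × O₁` with `⋆ = (σO, σ₁)`, `R = 𝒪_E[x]`, `x = (u, λ)` as in ★ `QuadraticRamifiedOrderMonogenic`, with the unitarity relations `uσu = 1`, `DσD = 1`, `σt = tσD`,
`σy = −yσD` (so `x·x⋆ = 1` and `R⋆ = R`).  `N(c) = c·c⋆` maps `Λ^×` ONTO the fixed units `(Λ^⋆)^×` (unit norms onto on both factors), `C := N⁻¹(R^×) ≥ R^×`, and ★
`relIndex_comap_norm_mul_relIndex_eq_index` gives `[C : R^×]·[(Λ^⋆)^× : R^{⋆×}] = [Λ^× : R^×] = (q²−1) q^{2(N+n−1)}` (★ `index_units_range_eval₂_eq` at `q_E = q²`).  The fixed ring is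
`Λ^⋆ ≅ 𝒪_F × O₁^{σ₁}` with `O₁^{σ₁} = j′𝒪_F ⊕ j′𝒪_F θ` again of the abstract shape, `R^⋆ = R ∩ Λ^⋆` is local with residue field `𝓀_F` and contains `ϖ^{N+n}Λ^⋆`, and
`[Λ^⋆ : R^⋆] = q^{N+n}` by ★ descent `[Λ : R] = [Λ^⋆ : R^⋆]²`; so ★ `index_range_units_map_prod_mul_eq` gives `[(Λ^⋆)^× : R^{⋆×}] = (q−1) q^{N+n−1}` and
**`[C : R^×] = (q + 1) · q^{N+n−1}`** — Rogawski's count of self-dual `δ`-cyclic lattices on the good type-(2) class.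

* §1 `map_k₀_mem_maximalIdeal`, `sigma1_involutive`, `star_gen_eq_inv`, `star_mem_range_eval₂`; §2 `range_norm_eq` (norm onto the fixed units);
  §3 the fixed-side model `exists_coord_fixed`, `isLocalRing_comap_fixed`, `natCard_residueField_comap_fixed`, `index_comap_fixed_eq_pow`, `index_units_comap_fixed_eq`, `relIndex_units_fixed_eq`;
  §4 **`relIndex_units_comap_norm_eq`**.

## References
* [Rogawski1990] J. D. Rogawski, *Automorphic Representations of Unitary Groups in Three Variables* (1990): §4.9 Lemma 4.9.3 p. 56, Prop. 4.9.1 (b) p. 55.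
* [SerreLocalFields1979] J.-P. Serre, *Local Fields*, GTM 67 (1979): Ch. V §2 Prop. 3 and Corollary (unit norms at an unramified extension); Ch. I §6 Prop. 17–18.
* [Neukirch1999] J. Neukirch, *Algebraic Number Theory*, Grundlehren 322 (1999): Ch. I §12 (orders, conductor, unit indices).
* [Jacobowitz1962] R. Jacobowitz, *Hermitian forms over local fields*, Amer. J. Math. 84 (1962): §7 (lattices of an order as a units-torsor).
-/

set_option autoImplicit false

noncomputable section

open scoped ValuativeRel
open Polynomial ValuativeRel

namespace Literature.NumberTheory.Automorphic

open Literature.RingTheory.GaloisAlgebras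

/-! ## §1 Units of a subring; the involution on `Λ = 𝒪_E × O₁` and the `⋆`-stability of `R` -/

variable {F E : Type*} [Field F] [ValuativeRel F] [Field E] [ValuativeRel E] {O₁ : Type*} [CommRing O₁]
  (ιO : 𝒪[F] →+* 𝒪[E]) (σO : 𝒪[E] →+* 𝒪[E]) (j : 𝒪[E] →+* O₁) (σ₁ : O₁ →+* O₁) (θ : O₁) {k₀F : 𝒪[F]}
  (hσσ : ∀ x, σO (σO x) = x) (hσι : ∀ y, σO (ιO y) = ιO y) (hfixO : ∀ x, σO x = x → ∃ y, ιO y = x) (hιinj : Function.Injective ιO)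
  (hιu : ∀ y, IsUnit (ιO y) → IsUnit y)
  (hσ₁j : ∀ x, σ₁ (j x) = j (σO x)) (hσ₁θ : σ₁ θ = θ)
  (hθ : θ ^ 2 = j (ιO k₀F)) (hk₀ : k₀F ∈ IsLocalRing.maximalIdeal 𝒪[F])
  (hcoord : ∀ z : O₁, ∃! bc : 𝒪[E] × 𝒪[E], z = j bc.1 + j bc.2 * θ)
  (u : 𝒪[E]) {t y D e₂ : 𝒪[E]} (h2 : e₂ * 2 = 1) (hD : 4 * D = t * t - y * y * ιO k₀F) {lam : O₁} (hlam : lam = j (e₂ * t) + j (e₂ * y) * θ)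
  (hu1 : u - 1 ∈ IsLocalRing.maximalIdeal 𝒪[E]) (ht2 : t - 2 ∈ IsLocalRing.maximalIdeal 𝒪[E])
  (hσu : u * σO u = 1) (hσD : D * σO D = 1) (hσt : σO t = t * σO D) (hσy : σO y = -(y * σO D))

include hιu hk₀ in
/-- `k₀ = ιO k₀F ∈ 𝔪_E` (`ιO` reflects units). [cite: SerreLocalFields1979, Ch. I §6] -/
theorem map_k₀_mem_maximalIdeal : ιO k₀F ∈ IsLocalRing.maximalIdeal 𝒪[E] := by
  rw [IsLocalRing.mem_maximalIdeal, mem_nonunits_iff]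
  intro h
  exact (IsLocalRing.mem_maximalIdeal _ |>.1 hk₀) (hιu _ h)

include hσσ hσ₁j hσ₁θ hcoord in
/-- `σ₁` is an involution (it is `σO` on coordinates). [cite: SerreLocalFields1979, Ch. I §6] -/
theorem sigma1_involutive (z : O₁) : σ₁ (σ₁ z) = z := by
  obtain ⟨⟨b, c⟩, hz, -⟩ := hcoord z
  rw [hz]
  simp only [map_add, map_mul, hσ₁j, hσ₁θ, hσσ]

include h2 hD hlam hσ₁j hσ₁θ hθ hσu hσD hσt hσy in
/-- **`x · x⋆ = 1`** for `x = (u, λ)`: `uσu = 1` and `λ·σ₁λ = e₂²((tσt + yσy·k₀) + (tσy + yσt)θ) = e₂²·4D·σD = 1`. [cite: Rogawski1990, §4.9 p. 55] -/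
theorem gen_mul_star_eq_one : ((u, lam) : 𝒪[E] × O₁) * RingHom.prodMap σO σ₁ (u, lam) = 1 := by
  have he₂ : σO e₂ = e₂ := by
    have h1 : σO e₂ * 2 = 1 := by
      have := congrArg σO h2; rwa [map_mul, map_ofNat, map_one] at this
    calc σO e₂ = σO e₂ * (e₂ * 2) := by rw [h2, mul_one]
      _ = (σO e₂ * 2) * e₂ := by ring
      _ = e₂ := by rw [h1, one_mul]
  have hθ2 : θ * θ = j (ιO k₀F) := by rw [← sq, hθ]
  change ((u, lam) : 𝒪[E] × O₁) * (σO u, σ₁ lam) = 1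
  rw [Prod.mk_mul_mk, Prod.mk_eq_one]
  refine ⟨hσu, ?_⟩
  rw [hlam]
  simp only [map_add, map_mul, hσ₁j, hσ₁θ, he₂, hσt, hσy, map_neg]
  have key : (j e₂ * j t + j e₂ * j y * θ) * (j e₂ * (j t * j (σO D)) + j e₂ * -(j y * j (σO D)) * θ)
      = j e₂ * j e₂ * j (σO D) * (j t * j t - j y * j y * (θ * θ)) := by ring
  rw [key, hθ2, ← map_mul, ← map_mul, ← map_mul, ← map_mul, ← map_mul, ← map_sub, ← map_mul, ← hD]
  have : e₂ * e₂ * σO D * (4 * D) = 1 := by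
    calc e₂ * e₂ * σO D * (4 * D) = (e₂ * 2) * (e₂ * 2) * (D * σO D) := by ring
      _ = 1 := by rw [h2, hσD]; ring
  rw [this, map_one]

include hθ hιu hk₀ hcoord h2 hD hlam hσ₁j hσ₁θ hσu hσD hσt hσy in
/-- **`R⋆ = R`**: `⋆` maps `R = 𝒪[x]` into itself (`x⋆ = x⁻¹ ∈ R` by ★ `inv_mem_range_eval₂`, constants go to constants). [cite: Rogawski1990, §4.9 p. 55] -/
theorem star_mem_range_eval₂ {z : 𝒪[E] × O₁}
    (hz : z ∈ (Polynomial.eval₂RingHom (RingHom.prod (RingHom.id 𝒪[E]) j) ((u, lam) : 𝒪[E] × O₁)).range) :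
    RingHom.prodMap σO σ₁ z ∈ (Polynomial.eval₂RingHom (RingHom.prod (RingHom.id 𝒪[E]) j) ((u, lam) : 𝒪[E] × O₁)).range := by
  set R := (Polynomial.eval₂RingHom (RingHom.prod (RingHom.id 𝒪[E]) j) ((u, lam) : 𝒪[E] × O₁)).range with hR
  have hk : ιO k₀F ∈ IsLocalRing.maximalIdeal 𝒪[E] := map_k₀_mem_maximalIdeal ιO hιu hk₀
  -- `x⋆ = x⁻¹ ∈ R`
  have hx1 := gen_mul_star_eq_one ιO σO j σ₁ θ hσ₁j hσ₁θ hθ u h2 hD hlam hσu hσD hσt hσy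
  have hxu : IsUnit ((u, lam) : 𝒪[E] × O₁) := IsUnit.of_mul_eq_one _ hx1
  have hxinv : RingHom.prodMap σO σ₁ (u, lam) = ↑hxu.unit⁻¹ := (Units.inv_eq_of_mul_eq_one_right (by rw [IsUnit.unit_spec]; exact hx1)).symm
  have hstarx : RingHom.prodMap σO σ₁ (u, lam) ∈ R := by
    rw [hxinv]; exact inv_mem_range_eval₂ j θ hθ hk hcoord u hxu (gen_mem_range_eval₂ j u)
  -- three-term form
  obtain ⟨c, rfl⟩ := (mem_range_eval₂_iff j θ hθ u h2 hD hlam z).1 hz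
  have hconst : ∀ a : 𝒪[E], RingHom.prodMap σO σ₁ (a, j a) = (σO a, j (σO a)) := fun a => by
    change (σO a, σ₁ (j a)) = _; rw [hσ₁j]
  simp only [map_add, map_mul, map_pow, hconst]
  exact R.add_mem (R.add_mem (const_mem_range_eval₂ j u _) (R.mul_mem (const_mem_range_eval₂ j u _) hstarx))
    (R.mul_mem (const_mem_range_eval₂ j u _) (R.pow_mem hstarx 2))

/-! ## §2 The norm maps `Λ^×` onto the fixed units -/

include hσσ hσ₁j hσ₁θ hcoord in
/-- `⋆ = (σO, σ₁)` is an involution of `Λ`. [cite: SerreLocalFields1979, Ch. I §6] -/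
theorem star_involutive (z : 𝒪[E] × O₁) : RingHom.prodMap σO σ₁ (RingHom.prodMap σO σ₁ z) = z := by
  obtain ⟨a, w⟩ := z
  change (σO (σO a), σ₁ (σ₁ w)) = (a, w)
  rw [hσσ, sigma1_involutive σO j σ₁ θ hσσ hσ₁j hσ₁θ hcoord]

variable (hnormE : ∀ a : 𝒪[E], IsUnit a → σO a = a → ∃ b : 𝒪[E], b * σO b = a)
  (hnorm₁ : ∀ z : O₁, IsUnit z → σ₁ z = z → ∃ w : O₁, w * σ₁ w = z)

include hσσ hσ₁j hσ₁θ hcoord hnormE hnorm₁ in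
/-- **THE NORM IS ONTO THE FIXED UNITS**: `range (id · ⋆) = (Λ^⋆)^×` on `Λ^×` (unit norms onto on both factors; ★ `range_norm_eq_units_eqLocus`).
[cite: SerreLocalFields1979, Ch. V §2 Prop. 3 and Corollary] -/
theorem range_norm_eq :
    (MonoidHom.id (𝒪[E] × O₁)ˣ * Units.map (RingHom.prodMap σO σ₁ : 𝒪[E] × O₁ →* 𝒪[E] × O₁)).range =
      (RingHom.eqLocus (RingHom.prodMap σO σ₁) (RingHom.id (𝒪[E] × O₁))).toSubmonoid.units := by
  refine range_norm_eq_units_eqLocus (RingHom.prodMap σO σ₁) (star_involutive σO j σ₁ θ hσσ hσ₁j hσ₁θ hcoord) ?_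
  intro w hw
  have hw' : σO (w : 𝒪[E] × O₁).1 = (w : 𝒪[E] × O₁).1 ∧ σ₁ (w : 𝒪[E] × O₁).2 = (w : 𝒪[E] × O₁).2 := Prod.ext_iff.1 hw
  have hwu := Prod.isUnit_iff.1 w.isUnit
  obtain ⟨b, hb⟩ := hnormE _ hwu.1 hw'.1
  obtain ⟨v, hv⟩ := hnorm₁ _ hwu.2 hw'.2
  have hbu : IsUnit b := isUnit_of_mul_isUnit_left (by rw [hb]; exact hwu.1)
  have hvu : IsUnit v := isUnit_of_mul_isUnit_left (by rw [hv]; exact hwu.2)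
  refine ⟨(Prod.isUnit_iff.2 ⟨hbu, hvu⟩ : IsUnit ((b, v) : 𝒪[E] × O₁)).unit, ?_⟩
  rw [IsUnit.unit_spec]
  change ((b, v) : 𝒪[E] × O₁) * (σO b, σ₁ v) = _
  rw [Prod.mk_mul_mk, hb, hv]

/-! ## §3 The fixed side: `Λ^⋆ ≅ 𝒪_F × O₁^{σ₁}`, `R^⋆` local with residue field `𝓀_F`, `[Λ^⋆ : R^⋆] = q^{N+n}`, `[(Λ^⋆)^× : R^{⋆×}] = (q−1)q^{N+n−1}` -/

include hfixO hιinj hσ₁j hσ₁θ hcoord in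
/-- **COORDINATES ON THE FIXED RING `O₁^{σ₁} = j′𝒪_F ⊕ j′𝒪_F θ`** (`j′ = j ∘ ιO` co-restricted): a `σ₁`-fixed `z = jb + jcθ` has `σ`-fixed, hence `F`-rational, coordinates.
[cite: SerreLocalFields1979, Ch. I §6 Prop. 18] -/
theorem exists_coord_fixed (hj' : ∀ y : 𝒪[F], (j.comp ιO) y ∈ RingHom.eqLocus σ₁ (RingHom.id O₁)) (hθ' : θ ∈ RingHom.eqLocus σ₁ (RingHom.id O₁)) :
    ∀ z : RingHom.eqLocus σ₁ (RingHom.id O₁), ∃! bc : 𝒪[F] × 𝒪[F],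
      z = ((j.comp ιO).codRestrict (RingHom.eqLocus σ₁ (RingHom.id O₁)) hj') bc.1 +
        ((j.comp ιO).codRestrict (RingHom.eqLocus σ₁ (RingHom.id O₁)) hj') bc.2 * ⟨θ, hθ'⟩ := by
  intro z
  obtain ⟨⟨b, c⟩, hz, huniq⟩ := hcoord (z : O₁)
  simp only at hz
  have hfix : σ₁ (z : O₁) = z := z.2
  have hfix' : j (σO b) + j (σO c) * θ = j b + j c * θ := by
    have := hfix
    rw [hz, map_add, map_mul, hσ₁j, hσ₁j, hσ₁θ] at this
    exact this
  obtain ⟨hb, hc⟩ := coord_unique j θ hcoord hfix'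
  obtain ⟨b', hb'⟩ := hfixO b hb
  obtain ⟨c', hc'⟩ := hfixO c hc
  refine ⟨(b', c'), Subtype.ext ?_, ?_⟩
  · simp only [Subring.coe_add, Subring.coe_mul, RingHom.codRestrict_apply, RingHom.coe_comp, Function.comp_apply, hb', hc']
    exact hz
  · rintro ⟨b'', c''⟩ h
    have h' := congrArg (Subtype.val) h
    simp only [Subring.coe_add, Subring.coe_mul, RingHom.codRestrict_apply, RingHom.coe_comp, Function.comp_apply] at h'
    rw [hz] at h'
    obtain ⟨h1, h2⟩ := coord_unique j θ hcoord h'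
    rw [← hb'] at h1; rw [← hc'] at h2
    exact Prod.ext (hιinj h1).symm (hιinj h2).symm

include hσι hσ₁j hσ₁θ in
/-- `j′ = j ∘ ιO` lands in the `σ₁`-fixed subring, as does `θ`. [cite: SerreLocalFields1979, Ch. I §6] -/
theorem comp_mem_eqLocus : (∀ y : 𝒪[F], (j.comp ιO) y ∈ RingHom.eqLocus σ₁ (RingHom.id O₁)) ∧ θ ∈ RingHom.eqLocus σ₁ (RingHom.id O₁) := by
  refine ⟨fun y => ?_, ?_⟩
  · rw [RingHom.mem_eqLocus, RingHom.coe_comp, Function.comp_apply, hσ₁j, hσι]; rfl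
  · rw [RingHom.mem_eqLocus, hσ₁θ]; rfl

include hσι hfixO in
/-- **THE FIXED RING OF `Λ` IS THE RANGE OF `Ψ₀ = (ιO, incl) : 𝒪_F × O₁^{σ₁} → Λ`.** [cite: SerreLocalFields1979, Ch. V §2] -/
theorem mem_eqLocus_prodMap_iff (z : 𝒪[E] × O₁) :
    z ∈ RingHom.eqLocus (RingHom.prodMap σO σ₁) (RingHom.id (𝒪[E] × O₁)) ↔
      ∃ p : 𝒪[F] × RingHom.eqLocus σ₁ (RingHom.id O₁), RingHom.prodMap ιO (RingHom.eqLocus σ₁ (RingHom.id O₁)).subtype p = z := by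
  obtain ⟨a, w⟩ := z
  rw [RingHom.mem_eqLocus]
  change (σO a, σ₁ w) = (a, w) ↔ _
  rw [Prod.mk.injEq]
  constructor
  · rintro ⟨ha, hw⟩
    obtain ⟨a', rfl⟩ := hfixO a ha
    exact ⟨(a', ⟨w, hw⟩), rfl⟩
  · rintro ⟨⟨a', w'⟩, h⟩
    have h' : (ιO a', (w' : O₁)) = (a, w) := h
    rw [Prod.mk.injEq] at h'
    obtain ⟨rfl, rfl⟩ := h'
    exact ⟨hσι a', w'.2⟩

include hιinj in
/-- `Ψ₀ = (ιO, incl)` is injective. [cite: SerreLocalFields1979, Ch. V §2] -/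
theorem prodMap_subtype_injective :
    Function.Injective (RingHom.prodMap ιO (RingHom.eqLocus σ₁ (RingHom.id O₁)).subtype) := by
  rintro ⟨a, w⟩ ⟨a', w'⟩ h
  have h' : (ιO a, (w : O₁)) = (ιO a', (w' : O₁)) := h
  rw [Prod.mk.injEq] at h'
  exact Prod.ext (hιinj h'.1) (Subtype.ext h'.2)

variable {ϖF : F} (hϖF : IsUniformizingElement ϖF) {ϖ : E} (hϖ : IsUniformizingElement ϖ)
  (hιϖ : ιO ⟨ϖF, hϖF.mem⟩ = ⟨ϖ, hϖ.mem⟩) {n N : ℕ}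
  (hn : valuation E ((u * u - t * u + D : 𝒪[E]) : E) = valuation E ϖ ^ n) (hN : valuation E ((y : 𝒪[E]) : E) = valuation E ϖ ^ N)

include hσσ hσι hfixO hιinj hιu hσ₁j hσ₁θ hθ hk₀ hcoord h2 hD hlam hu1 ht2 in
/-- **`R^⋆ = R ∩ Λ^⋆` (pulled back along `Ψ₀`) IS LOCAL**, its units being detected by the residue of the first (`𝒪_F`-) coordinate. [cite: Neukirch1999, Ch. I §12] -/
theorem isLocalRing_comap_fixed :
    IsLocalRing ((Polynomial.eval₂RingHom (RingHom.prod (RingHom.id 𝒪[E]) j) ((u, lam) : 𝒪[E] × O₁)).range.comap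
      (RingHom.prodMap ιO (RingHom.eqLocus σ₁ (RingHom.id O₁)).subtype)) ∧
    ∀ r : (Polynomial.eval₂RingHom (RingHom.prod (RingHom.id 𝒪[E]) j) ((u, lam) : 𝒪[E] × O₁)).range.comap
      (RingHom.prodMap ιO (RingHom.eqLocus σ₁ (RingHom.id O₁)).subtype), IsUnit r ↔ IsUnit (r : 𝒪[F] × RingHom.eqLocus σ₁ (RingHom.id O₁)).1 := by
  set R := (Polynomial.eval₂RingHom (RingHom.prod (RingHom.id 𝒪[E]) j) ((u, lam) : 𝒪[E] × O₁)).range with hR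
  set Ψ₀ := RingHom.prodMap ιO (RingHom.eqLocus σ₁ (RingHom.id O₁)).subtype with hΨ₀
  set R₀ := R.comap Ψ₀ with hR₀
  have hk : ιO k₀F ∈ IsLocalRing.maximalIdeal 𝒪[E] := map_k₀_mem_maximalIdeal ιO hιu hk₀
  have hstar := star_involutive σO j σ₁ θ hσσ hσ₁j hσ₁θ hcoord
  have hunit : ∀ r : R₀, IsUnit r ↔ IsUnit (r : 𝒪[F] × RingHom.eqLocus σ₁ (RingHom.id O₁)).1 := by
    intro r
    constructor
    · intro h
      exact (Prod.isUnit_iff.1 ((h.map R₀.subtype))).1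
    · intro h1
      have hmem : Ψ₀ (r : 𝒪[F] × _) ∈ R := r.2
      have hfst : IsUnit (Ψ₀ (r : 𝒪[F] × _)).1 := h1.map ιO
      have hzu : IsUnit (Ψ₀ (r : 𝒪[F] × _)) := (isUnit_iff_isUnit_fst_of_mem_range j θ hθ hk hcoord u h2 hD hlam hu1 ht2 hmem).2 hfst
      have hinv := inv_mem_range_eval₂ j θ hθ hk hcoord u hzu hmem
      -- the inverse is fixed, hence in the range of `Ψ₀`
      have hfixz : RingHom.prodMap σO σ₁ (Ψ₀ (r : 𝒪[F] × _)) = Ψ₀ (r : 𝒪[F] × _) :=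
        (mem_eqLocus_prodMap_iff ιO σO σ₁ hσι hfixO _).2 ⟨_, rfl⟩
      have hfixinv : RingHom.prodMap σO σ₁ (↑hzu.unit⁻¹ : 𝒪[E] × O₁) = ↑hzu.unit⁻¹ := by
        have h := congrArg (RingHom.prodMap σO σ₁) hzu.unit.inv_mul
        rw [map_mul, map_one, IsUnit.unit_spec, hfixz] at h
        have h' : RingHom.prodMap σO σ₁ (↑hzu.unit⁻¹ : 𝒪[E] × O₁) * (hzu.unit : 𝒪[E] × O₁) = 1 := by
          rw [IsUnit.unit_spec]; exact h
        exact (Units.inv_eq_of_mul_eq_one_left h').symm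
      obtain ⟨s, hs⟩ := (mem_eqLocus_prodMap_iff ιO σO σ₁ hσι hfixO _).1 (RingHom.mem_eqLocus.2 hfixinv)
      have hsR : s ∈ R₀ := by
        change Ψ₀ s ∈ R; rw [hs]; exact hinv
      refine IsUnit.of_mul_eq_one ⟨s, hsR⟩ (Subtype.ext (prodMap_subtype_injective ιO σ₁ hιinj ?_))
      change Ψ₀ ((r : 𝒪[F] × _) * s) = Ψ₀ 1
      rw [map_mul, map_one, hs, IsUnit.mul_val_inv]
  refine ⟨?_, hunit⟩
  haveI : Nontrivial R₀ := by
    refine ⟨⟨0, 1, fun h => ?_⟩⟩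
    have := congrArg (fun r : R₀ => (r : 𝒪[F] × RingHom.eqLocus σ₁ (RingHom.id O₁)).1) h
    simp at this
  refine IsLocalRing.of_nonunits_add ?_
  intro a b ha hb
  rw [mem_nonunits_iff, hunit] at ha hb ⊢
  rw [Subring.coe_add, Prod.fst_add]
  intro hab
  have ham : (a : 𝒪[F] × RingHom.eqLocus σ₁ (RingHom.id O₁)).1 ∈ IsLocalRing.maximalIdeal 𝒪[F] :=
    (IsLocalRing.mem_maximalIdeal ((a : 𝒪[F] × RingHom.eqLocus σ₁ (RingHom.id O₁)).1)).2 ha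
  have hbm : (b : 𝒪[F] × RingHom.eqLocus σ₁ (RingHom.id O₁)).1 ∈ IsLocalRing.maximalIdeal 𝒪[F] :=
    (IsLocalRing.mem_maximalIdeal ((b : 𝒪[F] × RingHom.eqLocus σ₁ (RingHom.id O₁)).1)).2 hb
  exact (IsLocalRing.mem_maximalIdeal _ |>.1 (Ideal.add_mem _ ham hbm)) hab

include hσσ hσι hfixO hιinj hιu hσ₁j hσ₁θ hθ hk₀ hcoord h2 hD hlam hu1 ht2 in
/-- **THE RESIDUE FIELD OF `R^⋆` IS `𝓀_F`**: `#k_{R^⋆} = q`. [cite: Neukirch1999, Ch. I §12] -/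
theorem natCard_residueField_comap_fixed :
    @Nat.card (@IsLocalRing.ResidueField ((Polynomial.eval₂RingHom (RingHom.prod (RingHom.id 𝒪[E]) j) ((u, lam) : 𝒪[E] × O₁)).range.comap
      (RingHom.prodMap ιO (RingHom.eqLocus σ₁ (RingHom.id O₁)).subtype)) _
      (isLocalRing_comap_fixed ιO σO j σ₁ θ hσσ hσι hfixO hιinj hιu hσ₁j hσ₁θ hθ hk₀ hcoord u h2 hD hlam hu1 ht2).1) = Nat.card 𝓀[F] := by
  set R := (Polynomial.eval₂RingHom (RingHom.prod (RingHom.id 𝒪[E]) j) ((u, lam) : 𝒪[E] × O₁)).range with hR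
  set Ψ₀ := RingHom.prodMap ιO (RingHom.eqLocus σ₁ (RingHom.id O₁)).subtype with hΨ₀
  set R₀ := R.comap Ψ₀ with hR₀
  obtain ⟨hloc, hunit⟩ := isLocalRing_comap_fixed ιO σO j σ₁ θ hσσ hσι hfixO hιinj hιu hσ₁j hσ₁θ hθ hk₀ hcoord u h2 hD hlam hu1 ht2
  letI := hloc
  obtain ⟨hj', hθ'⟩ := comp_mem_eqLocus ιO σO j σ₁ θ hσι hσ₁j hσ₁θ
  set χ : R₀ →+* 𝓀[F] := (IsLocalRing.residue 𝒪[F]).comp ((RingHom.fst 𝒪[F] (RingHom.eqLocus σ₁ (RingHom.id O₁))).comp R₀.subtype) with hχ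
  have hχapp : ∀ r : R₀, χ r = IsLocalRing.residue 𝒪[F] (r : 𝒪[F] × RingHom.eqLocus σ₁ (RingHom.id O₁)).1 := fun _ => rfl
  have hsurj : Function.Surjective χ := by
    intro x
    obtain ⟨c, rfl⟩ := IsLocalRing.residue_surjective x
    have hmem : ((c, ((j.comp ιO).codRestrict (RingHom.eqLocus σ₁ (RingHom.id O₁)) hj') c) : 𝒪[F] × RingHom.eqLocus σ₁ (RingHom.id O₁)) ∈ R₀ := by
      change Ψ₀ _ ∈ R
      exact const_mem_range_eval₂ j u (ιO c)
    exact ⟨⟨_, hmem⟩, rfl⟩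
  have hker : RingHom.ker χ = IsLocalRing.maximalIdeal R₀ := by
    ext r
    rw [RingHom.mem_ker, hχapp, IsLocalRing.residue_eq_zero_iff, IsLocalRing.mem_maximalIdeal, IsLocalRing.mem_maximalIdeal, mem_nonunits_iff,
      mem_nonunits_iff, hunit]
  unfold IsLocalRing.ResidueField
  rw [← hker]
  exact Nat.card_congr (RingHom.quotientKerEquivOfSurjective hsurj).toEquiv

variable [Finite 𝓀[F]] [Finite 𝓀[E]] [IsDiscreteValuationRing 𝒪[E]] (hq : Nat.card 𝓀[E] = Nat.card 𝓀[F] ^ 2) {ξ : 𝒪[E]} (hξ : IsUnit (ξ - σO ξ))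

omit [Finite 𝓀[F]] [Finite 𝓀[E]] in
include hσσ hσι hfixO hιu hσ₁j hσ₁θ hθ hk₀ hcoord h2 hD hlam hσu hσD hσt hσy hϖ hn hN hq hξ in
/-- **`[Λ^⋆ : R^⋆] = q^{N+n}`**: ★ descent `[Λ : R] = [Λ^⋆ : R^⋆]²` along `ξΛ = (ξ, jξ)` with `[Λ : R] = q_E^{N+n} = q^{2(N+n)}`. [cite: Neukirch1999, Ch. I §12] -/
theorem index_comap_fixed_eq_pow :
    ((Polynomial.eval₂RingHom (RingHom.prod (RingHom.id 𝒪[E]) j) ((u, lam) : 𝒪[E] × O₁)).range.comap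
      (RingHom.prodMap ιO (RingHom.eqLocus σ₁ (RingHom.id O₁)).subtype)).toAddSubgroup.index = Nat.card 𝓀[F] ^ (N + n) := by
  set R := (Polynomial.eval₂RingHom (RingHom.prod (RingHom.id 𝒪[E]) j) ((u, lam) : 𝒪[E] × O₁)).range with hR
  set Ψ₀ := RingHom.prodMap ιO (RingHom.eqLocus σ₁ (RingHom.id O₁)).subtype with hΨ₀
  set B₀ := RingHom.eqLocus (RingHom.prodMap σO σ₁) (RingHom.id (𝒪[E] × O₁)) with hB₀
  have hk : ιO k₀F ∈ IsLocalRing.maximalIdeal 𝒪[E] := map_k₀_mem_maximalIdeal ιO hιu hk₀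
  -- `[Λ : R] = q^{2(N+n)}`
  have hidx := index_range_eval₂_eq_pow j θ hθ hcoord u h2 hD hlam hϖ hn hN
  rw [hq, ← pow_mul] at hidx
  -- descent along `ξΛ = (ξ, jξ)`
  obtain ⟨ε, hε⟩ := hξ
  have hstar := star_involutive σO j σ₁ θ hσσ hσ₁j hσ₁θ hcoord
  have he : ((↑ε⁻¹, j ↑ε⁻¹) : 𝒪[E] × O₁) * (((ξ, j ξ) : 𝒪[E] × O₁) - RingHom.prodMap σO σ₁ (ξ, j ξ)) = 1 := by
    change ((↑ε⁻¹, j ↑ε⁻¹) : 𝒪[E] × O₁) * ((ξ, j ξ) - (σO ξ, σ₁ (j ξ))) = 1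
    rw [hσ₁j, Prod.mk_sub_mk, ← map_sub, Prod.mk_mul_mk, ← map_mul, ← hε, Units.inv_mul, map_one]; rfl
  have hsR : ∀ z ∈ R, RingHom.prodMap σO σ₁ z ∈ R := fun z hz =>
    star_mem_range_eval₂ ιO σO j σ₁ θ hιu hσ₁j hσ₁θ hθ hk₀ hcoord u h2 hD hlam hσu hσD hσt hσy hz
  have hdesc := index_eq_relIndex_eqLocus_sq (RingHom.prodMap σO σ₁) hstar he R hsR (const_mem_range_eval₂ j u ξ) (const_mem_range_eval₂ j u _)
  rw [hidx] at hdesc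
  -- `R^⋆` pulled back along `Ψ₀` has index `[Λ^⋆ : R ∩ Λ^⋆]`
  have hrange : Ψ₀.toAddMonoidHom.range = B₀.toAddSubgroup := by
    ext z
    rw [AddMonoidHom.mem_range, Subring.mem_toAddSubgroup, hB₀, mem_eqLocus_prodMap_iff ιO σO σ₁ hσι hfixO]
    rfl
  have hcomap : (R.comap Ψ₀).toAddSubgroup = R.toAddSubgroup.comap Ψ₀.toAddMonoidHom := rfl
  rw [hcomap, AddSubgroup.index_comap, hrange]
  have h2' : Nat.card 𝓀[F] ^ (2 * (N + n)) = (Nat.card 𝓀[F] ^ (N + n)) ^ 2 := by rw [← pow_mul, mul_comm]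
  rw [h2'] at hdesc
  exact Nat.pow_left_injective two_ne_zero hdesc.symm

omit [Finite 𝓀[E]] in
include hσσ hσι hfixO hιinj hιu hσ₁j hσ₁θ hθ hk₀ hcoord h2 hD hlam hu1 ht2 hσu hσD hσt hσy hϖ hιϖ hn hN hq hξ in
/-- **`[(Λ^⋆)^× : R^{⋆×}] = (q − 1) · q^{N+n−1}`** (★ `index_range_units_map_prod_mul_eq` on the fixed-side model `𝒪_F × O₁^{σ₁}`). [cite: Neukirch1999, Ch. I §12] -/
theorem index_units_comap_fixed_eq (hNn : 1 ≤ N + n) :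
    (Units.map (((Polynomial.eval₂RingHom (RingHom.prod (RingHom.id 𝒪[E]) j) ((u, lam) : 𝒪[E] × O₁)).range.comap
      (RingHom.prodMap ιO (RingHom.eqLocus σ₁ (RingHom.id O₁)).subtype)).subtype :
        ((Polynomial.eval₂RingHom (RingHom.prod (RingHom.id 𝒪[E]) j) ((u, lam) : 𝒪[E] × O₁)).range.comap
          (RingHom.prodMap ιO (RingHom.eqLocus σ₁ (RingHom.id O₁)).subtype)) →* 𝒪[F] × RingHom.eqLocus σ₁ (RingHom.id O₁))).range.index =
      (Nat.card 𝓀[F] - 1) * Nat.card 𝓀[F] ^ (N + n - 1) := by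
  set R := (Polynomial.eval₂RingHom (RingHom.prod (RingHom.id 𝒪[E]) j) ((u, lam) : 𝒪[E] × O₁)).range with hR
  set Ψ₀ := RingHom.prodMap ιO (RingHom.eqLocus σ₁ (RingHom.id O₁)).subtype with hΨ₀
  set R₀ := R.comap Ψ₀ with hR₀
  obtain ⟨hloc, -⟩ := isLocalRing_comap_fixed ιO σO j σ₁ θ hσσ hσι hfixO hιinj hιu hσ₁j hσ₁θ hθ hk₀ hcoord u h2 hD hlam hu1 ht2
  letI := hloc
  obtain ⟨hj', hθ'⟩ := comp_mem_eqLocus ιO σO j σ₁ θ hσι hσ₁j hσ₁θ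
  have hq1 : 1 < Nat.card 𝓀[F] := Finite.one_lt_card
  -- the fixed-side model data
  have hθ'' : (⟨θ, hθ'⟩ : RingHom.eqLocus σ₁ (RingHom.id O₁)) ^ 2 = ((j.comp ιO).codRestrict (RingHom.eqLocus σ₁ (RingHom.id O₁)) hj') k₀F :=
    Subtype.ext hθ
  have hcoord' := exists_coord_fixed ιO σO j σ₁ θ hfixO hιinj hσ₁j hσ₁θ hcoord hj' hθ'
  have hres := natCard_residueField_comap_fixed ιO σO j σ₁ θ hσσ hσι hfixO hιinj hιu hσ₁j hσ₁θ hθ hk₀ hcoord u h2 hD hlam hu1 ht2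
  have hcond : ∀ x : 𝒪[F] × RingHom.eqLocus σ₁ (RingHom.id O₁),
      (((⟨ϖF, hϖF.mem⟩ : 𝒪[F]) ^ (N + n), ((j.comp ιO).codRestrict (RingHom.eqLocus σ₁ (RingHom.id O₁)) hj') ((⟨ϖF, hϖF.mem⟩ : 𝒪[F]) ^ (N + n))) :
        𝒪[F] × RingHom.eqLocus σ₁ (RingHom.id O₁)) * x ∈ R₀ := by
    intro x
    change Ψ₀ _ ∈ R
    rw [map_mul]
    have hΨ : Ψ₀ (((⟨ϖF, hϖF.mem⟩ : 𝒪[F]) ^ (N + n), ((j.comp ιO).codRestrict (RingHom.eqLocus σ₁ (RingHom.id O₁)) hj') ((⟨ϖF, hϖF.mem⟩ : 𝒪[F]) ^ (N + n))))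
        = (((⟨ϖ, hϖ.mem⟩ : 𝒪[E]) ^ (N + n), j ((⟨ϖ, hϖ.mem⟩ : 𝒪[E]) ^ (N + n))) : 𝒪[E] × O₁) := by
      refine Prod.ext ?_ ?_
      · show ιO ((⟨ϖF, hϖF.mem⟩ : 𝒪[F]) ^ (N + n)) = (⟨ϖ, hϖ.mem⟩ : 𝒪[E]) ^ (N + n)
        rw [map_pow, hιϖ]
      · show ((j.comp ιO) ((⟨ϖF, hϖF.mem⟩ : 𝒪[F]) ^ (N + n)) : O₁) = j ((⟨ϖ, hϖ.mem⟩ : 𝒪[E]) ^ (N + n))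
        rw [RingHom.comp_apply, map_pow ιO, hιϖ]
    rw [hΨ]
    exact pow_mul_mem_range_eval₂ j θ hθ hcoord u h2 hD hlam hϖ hn hN _
  have key := index_range_units_map_prod_mul_eq ((j.comp ιO).codRestrict (RingHom.eqLocus σ₁ (RingHom.id O₁)) hj') ⟨θ, hθ'⟩ hθ'' hk₀ hcoord' hϖF hNn
    R₀ hres hcond
  rw [index_comap_fixed_eq_pow ιO σO j σ₁ θ hσσ hσι hfixO hιu hσ₁j hσ₁θ hθ hk₀ hcoord u h2 hD hlam hσu hσD hσt hσy hϖ hn hN hq hξ] at key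
  have hpow : Nat.card 𝓀[F] ^ (N + n) = Nat.card 𝓀[F] ^ (N + n - 1) * Nat.card 𝓀[F] := by
    rw [← pow_succ, Nat.sub_add_cancel hNn]
  rw [hpow, ← mul_assoc] at key
  exact Nat.eq_of_mul_eq_mul_right (by omega) key

omit [Finite 𝓀[E]] in
include hσσ hσι hfixO hιinj hιu hσ₁j hσ₁θ hθ hk₀ hcoord h2 hD hlam hu1 ht2 hσu hσD hσt hσy hϖ hιϖ hn hN hq hξ in
/-- **`[(Λ^⋆)^× : R^× ∩ (Λ^⋆)^×] = (q − 1) · q^{N+n−1}` INSIDE `Λ^×`**: the fixed units are the image of the units of the fixed-side model under `Ψ₀`, and `R^×` pulls back to `R^{⋆×}`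
(Mathlib `Subgroup.index_comap`). [cite: Neukirch1999, Ch. I §12] -/
theorem relIndex_units_fixed_eq (hNn : 1 ≤ N + n) :
    (Units.map ((Polynomial.eval₂RingHom (RingHom.prod (RingHom.id 𝒪[E]) j) ((u, lam) : 𝒪[E] × O₁)).range.subtype :
        (Polynomial.eval₂RingHom (RingHom.prod (RingHom.id 𝒪[E]) j) ((u, lam) : 𝒪[E] × O₁)).range →* 𝒪[E] × O₁)).range.relIndex
      (RingHom.eqLocus (RingHom.prodMap σO σ₁) (RingHom.id (𝒪[E] × O₁))).toSubmonoid.units = (Nat.card 𝓀[F] - 1) * Nat.card 𝓀[F] ^ (N + n - 1) := by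
  set R := (Polynomial.eval₂RingHom (RingHom.prod (RingHom.id 𝒪[E]) j) ((u, lam) : 𝒪[E] × O₁)).range with hR
  set Ψ₀ := RingHom.prodMap ιO (RingHom.eqLocus σ₁ (RingHom.id O₁)).subtype with hΨ₀
  set R₀ := R.comap Ψ₀ with hR₀
  set B₀ := RingHom.eqLocus (RingHom.prodMap σO σ₁) (RingHom.id (𝒪[E] × O₁)) with hB₀
  set V := (Units.map (R.subtype : R →* 𝒪[E] × O₁)).range with hV
  set Φ₀ : (𝒪[F] × RingHom.eqLocus σ₁ (RingHom.id O₁))ˣ →* (𝒪[E] × O₁)ˣ := Units.map (Ψ₀ : _ →* 𝒪[E] × O₁) with hΦ₀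
  have hinj := prodMap_subtype_injective ιO σ₁ hιinj
  -- `range Φ₀ = (Λ^⋆)^×`
  have hrange : Φ₀.range = B₀.toSubmonoid.units := by
    ext w
    rw [Submonoid.mem_units_iff, MonoidHom.mem_range]
    constructor
    · rintro ⟨w₀, rfl⟩
      refine ⟨(mem_eqLocus_prodMap_iff ιO σO σ₁ hσι hfixO _).2 ⟨(w₀ : 𝒪[F] × _), rfl⟩, (mem_eqLocus_prodMap_iff ιO σO σ₁ hσι hfixO _).2 ⟨(↑w₀⁻¹ : 𝒪[F] × _), ?_⟩⟩
      rw [hΦ₀, Units.coe_map_inv]; rfl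
    · rintro ⟨h1, h2⟩
      obtain ⟨p, hp⟩ := (mem_eqLocus_prodMap_iff ιO σO σ₁ hσι hfixO _).1 h1
      obtain ⟨p', hp'⟩ := (mem_eqLocus_prodMap_iff ιO σO σ₁ hσι hfixO _).1 h2
      have hpp : p * p' = 1 := hinj (by rw [map_mul, map_one]; change Ψ₀ p * Ψ₀ p' = 1; rw [hp, hp', Units.mul_inv])
      have hp'p : p' * p = 1 := by rw [mul_comm]; exact hpp
      exact ⟨⟨p, p', hpp, hp'p⟩, Units.ext hp⟩
  -- `R^×` pulls back to `R^{⋆×}`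
  have hcomap : V.comap Φ₀ = (Units.map (R₀.subtype : R₀ →* 𝒪[F] × RingHom.eqLocus σ₁ (RingHom.id O₁))).range := by
    ext w₀
    rw [Subgroup.mem_comap, hV, mem_range_units_map_subtype_iff, mem_range_units_map_subtype_iff, hΦ₀, Units.coe_map, Units.coe_map_inv]
    rfl
  have hidx := Subgroup.index_comap V Φ₀
  rw [hrange, hcomap, index_units_comap_fixed_eq ιO σO j σ₁ θ hσσ hσι hfixO hιinj hιu hσ₁j hσ₁θ hθ hk₀ hcoord u h2 hD hlam hu1 ht2 hσu hσD hσt hσy hϖF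
    hϖ hιϖ hn hN hq hξ hNn] at hidx
  exact hidx.symm

/-! ## §4 The type-(2) unit index `[C : R^×]` -/

include hσσ hσι hfixO hιinj hιu hσ₁j hσ₁θ hθ hk₀ hcoord h2 hD hlam hu1 ht2 hσu hσD hσt hσy hϖ hιϖ hn hN hq hξ hnormE hnorm₁ in
/-- **THE TYPE-(2) UNIT INDEX `[C : R^×] = (q + 1) · q^{N+n−1}`.**  `Λ = 𝒪_E × O₁` with `⋆ = (σO, σ₁)`, `R = 𝒪_E[(u, λ)]` (deep norm-one `u`, `λ = (t + yθ)∕2` with the unitarity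
relations, `ord χ(u) = n`, `ord y = N`, `N + n ≥ 1`), `N(c) = c·c⋆` on `Λ^×` and `C := N⁻¹(R^×)` (`R^×` = `(Units.map R.subtype).range`): **`[C : R^×] = (q + 1) q^{N+n−1}`**, `q = #𝓀_F`
— ★ `relIndex_comap_norm_mul_relIndex_eq_index` with `[Λ^× : R^×] = (q² − 1) q^{2(N+n−1)}` (★ `index_units_range_eval₂_eq`, `q_E = q²`) and `[(Λ^⋆)^× : R^{⋆×}] = (q − 1) q^{N+n−1}` (§3).
At `F = L⁺_v`, `E = L_w`, `O₁ = 𝒪[K₁]` this is the count of self-dual `δ`-cyclic lattices on the good type-(2) class (T3′ P-2 row (R2²)).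
[cite: Rogawski1990, §4.9 Lemma 4.9.3 p. 56, Prop. 4.9.1 (b) p. 55] [cite: SerreLocalFields1979, Ch. V §2 Prop. 3] [cite: Jacobowitz1962, §7] -/
theorem relIndex_units_comap_norm_eq (hNn : 1 ≤ N + n) :
    (Units.map ((Polynomial.eval₂RingHom (RingHom.prod (RingHom.id 𝒪[E]) j) ((u, lam) : 𝒪[E] × O₁)).range.subtype :
        (Polynomial.eval₂RingHom (RingHom.prod (RingHom.id 𝒪[E]) j) ((u, lam) : 𝒪[E] × O₁)).range →* 𝒪[E] × O₁)).range.relIndex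
      ((Units.map ((Polynomial.eval₂RingHom (RingHom.prod (RingHom.id 𝒪[E]) j) ((u, lam) : 𝒪[E] × O₁)).range.subtype :
        (Polynomial.eval₂RingHom (RingHom.prod (RingHom.id 𝒪[E]) j) ((u, lam) : 𝒪[E] × O₁)).range →* 𝒪[E] × O₁)).range.comap
        (MonoidHom.id (𝒪[E] × O₁)ˣ * Units.map (RingHom.prodMap σO σ₁ : 𝒪[E] × O₁ →* 𝒪[E] × O₁))) =
      (Nat.card 𝓀[F] + 1) * Nat.card 𝓀[F] ^ (N + n - 1) := by
  set R := (Polynomial.eval₂RingHom (RingHom.prod (RingHom.id 𝒪[E]) j) ((u, lam) : 𝒪[E] × O₁)).range with hR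
  set V := (Units.map (R.subtype : R →* 𝒪[E] × O₁)).range with hV
  set Nm := MonoidHom.id (𝒪[E] × O₁)ˣ * Units.map (RingHom.prodMap σO σ₁ : 𝒪[E] × O₁ →* 𝒪[E] × O₁) with hNm
  have hk : ιO k₀F ∈ IsLocalRing.maximalIdeal 𝒪[E] := map_k₀_mem_maximalIdeal ιO hιu hk₀
  have hq1 : 1 < Nat.card 𝓀[F] := Finite.one_lt_card
  -- `N(V) ⊆ V`
  have hNval : ∀ v : (𝒪[E] × O₁)ˣ, ((Nm v : (𝒪[E] × O₁)ˣ) : 𝒪[E] × O₁) = (v : 𝒪[E] × O₁) * RingHom.prodMap σO σ₁ v := fun v => by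
    rw [hNm, MonoidHom.mul_apply, Units.val_mul, MonoidHom.id_apply, Units.coe_map]; rfl
  have hVN : V ≤ V.comap Nm := by
    intro v hv
    rw [Subgroup.mem_comap, hV, mem_range_units_map_subtype_iff, ← map_inv, hNval, hNval]
    rw [hV, mem_range_units_map_subtype_iff] at hv
    exact ⟨R.mul_mem hv.1 (star_mem_range_eval₂ ιO σO j σ₁ θ hιu hσ₁j hσ₁θ hθ hk₀ hcoord u h2 hD hlam hσu hσD hσt hσy hv.1),
      R.mul_mem hv.2 (star_mem_range_eval₂ ιO σO j σ₁ θ hιu hσ₁j hσ₁θ hθ hk₀ hcoord u h2 hD hlam hσu hσD hσt hσy hv.2)⟩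
  have key := relIndex_comap_norm_mul_relIndex_eq_index (RingHom.prodMap σO σ₁) V hVN
  rw [range_norm_eq σO j σ₁ θ hσσ hσ₁j hσ₁θ hcoord hnormE hnorm₁,
    relIndex_units_fixed_eq ιO σO j σ₁ θ hσσ hσι hfixO hιinj hιu hσ₁j hσ₁θ hθ hk₀ hcoord u h2 hD hlam hu1 ht2 hσu hσD hσt hσy hϖF hϖ hιϖ hn hN hq hξ hNn,
    hV, index_units_range_eval₂_eq j θ hθ hk hcoord u h2 hD hlam hϖ hn hN hu1 ht2 hNn, hq] at key
  -- arithmetic: `X · (q−1) q^m = (q²−1) (q²)^m`, `m = N + n − 1`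
  set m := N + n - 1 with hm
  obtain ⟨p, hp⟩ : ∃ p, Nat.card 𝓀[F] = p + 1 := ⟨Nat.card 𝓀[F] - 1, by omega⟩
  rw [hp] at key ⊢
  simp only [Nat.add_sub_cancel] at key ⊢
  have hp0 : 0 < p := by omega
  have hpos : 0 < p * (p + 1) ^ m := Nat.mul_pos hp0 (pow_pos (Nat.succ_pos p) _)
  refine Nat.eq_of_mul_eq_mul_right hpos ?_
  rw [key]
  have e1 : (p + 1) ^ 2 - 1 = p * (p + 2) := by
    have : (p + 1) ^ 2 = p * (p + 2) + 1 := by ring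
    omega
  rw [e1, ← pow_mul]
  ring

end Literature.NumberTheory.Automorphic

end
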